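import Summits.CriticalPhenomena.PercolationContinuityZ3.Theorems.PercNearOneGluingNoHeavyLowerTailAGPlusSwitching
import Summits.CriticalPhenomena.PercolationContinuityZ3.Theorems.PercNearOneGluingNoHeavyLowerTailThreePointRowsLeFive
import Mathlib.Tactic.Linarith
import HarnessLib

/-!
# `NoHeavyLowerTail` (stmt-CriticalPhenomena-4575) — the harness row `AG⁺` for EVERY `n`

Support file (prover prim-sahi-p2 gen 3; `--supports stmt-CriticalPhenomena-4575`).  No named facts, no sorries.

A one-line consequence of prim-ineq-prove-3's `AGPlusSwitching.agPlus_prodBernoulli` (`q·t − e₂(u) ≥ e₃(u)` on every finite weighted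
graph, three-copy switching certificate I4; an independent four-program certificate A4 of the same shape was found by this seat,
prim-sahi-p2 PROOF-E3 §11): `agPlus_row` — the row `AG⁺` (`Ξ = G3`) in the cell vocabulary `lq, lt, lu₁, lu₂, lu₃` of
`…ThreePointRowsLeFive` for EVERY `n` (there: `E3GroupSepCert.agPlus_le_five`, `n ≤ 5`, `native_decide`).  (`T_inc` from `AG⁺` is
`TIncSwitching.sahiE3_nonIsol_nonneg` / `…ThreePointRowLinks`.)
-/

noncomputable section

namespace Summit.CriticalPhenomena.PercolationContinuityZ3.Theorems

namespace AGPlusSwitching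

open MeasureTheory Literature.Probability.Percolation Literature.Probability.LatticeModels


section Row

open E3GroupSepCert

/-- **The harness row `AG⁺` (`Ξ = G3`) for every `n`** (cf. `E3GroupSepCert.agPlus_le_five`): for every weight `w` on `Sym2 (Fin n)` and
all `a b c`, `u₁u₂ + u₁u₃ + u₂u₃ + u₁u₂u₃ ≤ q·t`. [this work] -/
theorem agPlus_row (n : ℕ) (w : Sym2 (Fin n) → unitInterval) (a b c : Fin n) :
    lu₁ w a b c * lu₂ w a b c + lu₁ w a b c * lu₃ w a b c + lu₂ w a b c * lu₃ w a b c +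
        lu₁ w a b c * lu₂ w a b c * lu₃ w a b c ≤ lq w a b c * lt w a b c := by
  unfold lq lt lu₁ lu₂ lu₃
  rw [connEvent_pQ, connEvent_pU₁, connEvent_pU₂, connEvent_pU₃, connEvent_pT]
  have h := agPlus_prodBernoulli w a b c
  linarith

end Row

end AGPlusSwitching

end Summit.CriticalPhenomena.PercolationContinuityZ3.Theorems

end
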